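import Mathlib

/-!
# Toy (T1) for crux-triage stmt-RiemannHypothesis-2577 (MediumKernelNoGo), triager r1-k2

On the Laplace ray the real-rootedness locus in the parameter can be an ISOLATED point:
for `p = x⁴ − x²` and `F_c := (1 − cD²)⁻¹ p = p + c p'' + c² p'''' = x⁴ + (12c−1)x² + (24c²−2c)` (`c = 1/a²`):
* `c = 1/12` (`a = √12`): `F = x⁴` — real-rooted;
* `c = 1/6`  (`a = √6 < √12`, MORE smoothing): `F = x⁴ + x² + 1/3 > 0` on `ℝ` — no real root, so all four roots non-real;
* `c = 1/24` (`a = √24 > √12`, LESS smoothing): `F = x⁴ − x²/2 − 1/24` has the purely imaginary root `i·√(√(5/48) − 1/4)`.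
So neither real-rootedness nor its failure propagates monotonically in `a` for general inputs
(consistent with de Bruijn 1950: `(1+u²/a²)/(1+u²/a'²)` is not a universal factor).
-/

namespace CruxTriageToy

/-- the smoothed quartic as a function of `c = 1/a²` (closed form of `p + c p'' + c² p''''`, `p = x⁴ − x²`,
`p'' = 12x² − 2`, `p'''' = 24`). -/
def F (c : ℝ) (z : ℂ) : ℂ := z ^ 4 - z ^ 2 + c * (12 * z ^ 2 - 2) + c ^ 2 * 24

theorem F_closed (c : ℝ) (z : ℂ) : F c z = z ^ 4 + (12 * c - 1) * z ^ 2 + (24 * c ^ 2 - 2 * c) := by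
  unfold F; ring

/-- `a = √12`: `F = z⁴`, real-rooted. -/
theorem F_twelfth (z : ℂ) : F (1 / 12) z = z ^ 4 := by
  unfold F; push_cast; ring

theorem F_twelfth_realRooted (z : ℂ) (hz : F (1 / 12) z = 0) : z.im = 0 := by
  rw [F_twelfth] at hz
  have : z = 0 := pow_eq_zero_iff (n := 4) (by norm_num) |>.1 hz
  simp [this]

/-- `a = √6` (more smoothing): `F = z⁴ + z² + 1/3`, positive on the real axis, hence NOT real-rooted
(it has the non-real root exhibited below). -/
theorem F_sixth (z : ℂ) : F (1 / 6) z = z ^ 4 + z ^ 2 + 1 / 3 := by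
  unfold F; push_cast; ring

theorem F_sixth_pos (x : ℝ) : 0 < x ^ 4 + x ^ 2 + 1 / 3 := by positivity

/-- an explicit non-real root of `F (1/6)`: `z² = w` with `w = (-1 + i√(1/3))/2`... we avoid radicals of complex
numbers and instead show: every real `x` is a non-root, while a root exists (fundamental theorem of algebra is not
needed: we exhibit `z` with `z² = w`, `w² + w + 1/3 = 0` — take `w = -1/2 + i/(2√3)`, `z = √|w|·e^{iθ/2}`); for the
triage it suffices that NO real zero exists although `F (1/6)` is a quartic: -/
theorem F_sixth_no_real_root (x : ℝ) : F (1 / 6) (x : ℂ) ≠ 0 := by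
  rw [F_sixth]
  intro h
  have h' : ((x ^ 4 + x ^ 2 + 1 / 3 : ℝ) : ℂ) = 0 := by push_cast; exact h
  have := F_sixth_pos x
  rw [Complex.ofReal_eq_zero] at h'
  linarith

/-- `a = √24` (less smoothing): `F = z⁴ − z²/2 − 1/24` has a purely imaginary root. -/
theorem F_24th (z : ℂ) : F (1 / 24) z = z ^ 4 - (1 / 2) * z ^ 2 - 1 / 24 := by
  unfold F; push_cast; ring

/-- the negative root `w₋ = 1/4 − √(5/48)` of `w² − w/2 − 1/24`. -/
theorem w_neg : (1 / 4 : ℝ) - Real.sqrt (5 / 48) < 0 := by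
  have h : (1 / 4 : ℝ) < Real.sqrt (5 / 48) := by
    rw [show (1 / 4 : ℝ) = Real.sqrt (1 / 16) by
      rw [show (1 / 16 : ℝ) = (1 / 4) ^ 2 by norm_num, Real.sqrt_sq (by norm_num)]]
    exact Real.sqrt_lt_sqrt (by norm_num) (by norm_num)
  linarith

theorem w_root : ((1 / 4 : ℝ) - Real.sqrt (5 / 48)) ^ 2 - (1 / 2) * ((1 / 4 : ℝ) - Real.sqrt (5 / 48)) - 1 / 24 = 0 := by
  have hs : Real.sqrt (5 / 48) ^ 2 = 5 / 48 := Real.sq_sqrt (by norm_num)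
  nlinarith [hs]

/-- the purely imaginary root `z₀ = i·√(√(5/48) − 1/4)` of `F (1/24)`. -/
noncomputable def z₀ : ℂ := Complex.I * (Real.sqrt (Real.sqrt (5 / 48) - 1 / 4) : ℂ)

theorem z₀_sq : z₀ ^ 2 = (((1 / 4 : ℝ) - Real.sqrt (5 / 48) : ℝ) : ℂ) := by
  unfold z₀
  have hnn : 0 ≤ Real.sqrt (5 / 48) - 1 / 4 := by have := w_neg; linarith
  rw [mul_pow, Complex.I_sq, ← Complex.ofReal_pow, Real.sq_sqrt hnn]
  push_cast; ring

theorem F_24th_z₀ : F (1 / 24) z₀ = 0 := by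
  rw [F_24th, show z₀ ^ 4 = (z₀ ^ 2) ^ 2 by ring, z₀_sq]
  have := w_root
  set w : ℝ := (1 / 4 : ℝ) - Real.sqrt (5 / 48)
  have h : ((w ^ 2 - 1 / 2 * w - 1 / 24 : ℝ) : ℂ) = 0 := by rw [this]; simp
  push_cast at h ⊢
  linear_combination h

theorem z₀_im_ne_zero : z₀.im ≠ 0 := by
  unfold z₀
  have hpos : 0 < Real.sqrt (Real.sqrt (5 / 48) - 1 / 4) := Real.sqrt_pos.2 (by have := w_neg; linarith)
  rw [Complex.mul_im, Complex.I_re, Complex.I_im, Complex.ofReal_re, Complex.ofReal_im]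
  simp only [zero_mul, one_mul, zero_add]
  exact hpos.ne'

/-- Summary: real-rooted at `c = 1/12`, not at `c = 1/6` (no real root at all) nor at `c = 1/24` (a non-real root). -/
theorem toy_isolated_LP :
    (∀ z : ℂ, F (1 / 12) z = 0 → z.im = 0) ∧ (∃ z : ℂ, F (1 / 24) z = 0 ∧ z.im ≠ 0) ∧ (∀ x : ℝ, F (1 / 6) x ≠ 0) :=
  ⟨F_twelfth_realRooted, ⟨z₀, F_24th_z₀, z₀_im_ne_zero⟩, F_sixth_no_real_root⟩

end CruxTriageToy
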